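import Mathlib.Analysis.SpecialFunctions.Pow.Real
import HarnessLib

/-!
# Two elementary PSD criteria for quadratic forms given by explicit data

Framing: lottery ticket; floor = certified bounds/negative ranges. Venture `PackingBounds`, cell
`pub-packcert`, energy family E3PT (pub-packcert-energy gen 11) — infrastructure for kernel-checking large
exact SDP certificates (pub-packcert-energy/KERNEL-D6.md, step 3): once a checker has verified, on exact
data, that a symmetric matrix splits as `Y = L Lᵀ + E` (or `D·Y = L Lᵀ + E`, `D > 0`) with `E` symmetric
and diagonally dominant, these lemmas give `yᵀ Y y ≥ 0` for every real vector `y` WITHOUT expanding any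
polynomial identity:

* `quadForm_gram_eq`: `Σ_{i,j} (Σ_c L_{ic} L_{jc}) y_i y_j = Σ_c (Σ_i L_{ic} y_i)²` (`≥ 0`: `quadForm_gram_nonneg`);
* `quadForm_diagDominant_nonneg`: `E` symmetric with `Σ_j |E_{ij}| ≤ 2 E_{ii}` for every `i`
  (i.e. `E_{ii} ≥ Σ_{j≠i} |E_{ij}|`) implies `Σ_{i,j} E_{ij} y_i y_j ≥ 0`;
* `quadForm_split_nonneg`, `quadForm_scaled_split_nonneg`: the combinations.
-/

noncomputable section

open Finset

namespace Summit.Ventures.PackingBounds.Energy.GramPSD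

variable {ι κ : Type*} [Fintype ι] [Fintype κ]

/-- `Σ_{i,j} (Σ_c L_{ic} L_{jc}) y_i y_j = Σ_c (Σ_i L_{ic} y_i)²`. -/
theorem quadForm_gram_eq (L : ι → κ → ℝ) (y : ι → ℝ) :
    ∑ i, ∑ j, (∑ c, L i c * L j c) * y i * y j = ∑ c, (∑ i, L i c * y i) ^ 2 := by
  have h1 : ∀ c, (∑ i, L i c * y i) ^ 2 = ∑ i, ∑ j, L i c * y i * (L j c * y j) := by
    intro c
    rw [sq, Finset.sum_mul_sum (univ : Finset ι) (univ : Finset ι) (fun i => L i c * y i) (fun j => L j c * y j)]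
  have h2 : ∀ i j, (∑ c, L i c * L j c) * y i * y j = ∑ c, L i c * y i * (L j c * y j) := by
    intro i j
    rw [Finset.sum_mul, Finset.sum_mul]
    refine Finset.sum_congr rfl fun c _ => ?_
    ring
  simp_rw [h1, h2]
  calc ∑ i, ∑ j, ∑ c, L i c * y i * (L j c * y j)
      = ∑ i, ∑ c, ∑ j, L i c * y i * (L j c * y j) :=
        Finset.sum_congr rfl fun i _ => Finset.sum_comm
    _ = ∑ c, ∑ i, ∑ j, L i c * y i * (L j c * y j) := Finset.sum_comm

/-- A Gram form is nonnegative: `Σ_{i,j} (Σ_c L_{ic} L_{jc}) y_i y_j ≥ 0`. -/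
theorem quadForm_gram_nonneg (L : ι → κ → ℝ) (y : ι → ℝ) :
    0 ≤ ∑ i, ∑ j, (∑ c, L i c * L j c) * y i * y j := by
  rw [quadForm_gram_eq]
  exact Finset.sum_nonneg fun c _ => sq_nonneg _

/-- **Diagonal dominance ⇒ PSD.** If `E` is symmetric and `Σ_j |E_{ij}| ≤ 2 E_{ii}` for every `i`
(equivalently `E_{ii} ≥ Σ_{j ≠ i} |E_{ij}|`), then `Σ_{i,j} E_{ij} y_i y_j ≥ 0`. -/
theorem quadForm_diagDominant_nonneg [DecidableEq ι] (E : ι → ι → ℝ) (hs : ∀ i j, E i j = E j i)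
    (hdd : ∀ i, ∑ j, |E i j| ≤ 2 * E i i) (y : ι → ℝ) :
    0 ≤ ∑ i, ∑ j, E i j * y i * y j := by
  have hdiag : ∀ i, 0 ≤ E i i := by
    intro i
    have h := hdd i
    have h0 : 0 ≤ ∑ j, |E i j| := Finset.sum_nonneg fun j _ => abs_nonneg _
    linarith
  -- A_i := Σ_{j ≠ i} |E_ij| ≤ E_ii
  have hA : ∀ i, ∑ j ∈ univ.erase i, |E i j| ≤ E i i := by
    intro i
    have h := hdd i
    rw [← Finset.add_sum_erase univ (fun j => |E i j|) (Finset.mem_univ i),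
      abs_of_nonneg (hdiag i)] at h
    linarith
  -- termwise bound, doubled: -|E_ij| (y_i² + y_j²) ≤ 2 E_ij y_i y_j
  have hterm : ∀ i j, -(|E i j| * (y i ^ 2 + y j ^ 2)) ≤ 2 * (E i j * y i * y j) := by
    intro i j
    have h1 : |E i j * y i * y j| ≤ |E i j| * (y i ^ 2 + y j ^ 2) / 2 := by
      rw [abs_mul, abs_mul]
      have h2 : |y i| * |y j| ≤ (y i ^ 2 + y j ^ 2) / 2 := by
        have := two_mul_le_add_sq (|y i|) (|y j|)
        rw [sq_abs, sq_abs] at this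
        linarith
      have h3 : 0 ≤ |E i j| := abs_nonneg _
      calc |E i j| * |y i| * |y j| = |E i j| * (|y i| * |y j|) := by ring
        _ ≤ |E i j| * ((y i ^ 2 + y j ^ 2) / 2) := mul_le_mul_of_nonneg_left h2 h3
        _ = |E i j| * (y i ^ 2 + y j ^ 2) / 2 := by ring
    have := neg_abs_le (E i j * y i * y j)
    linarith
  -- row bound: 2 E_ii y_i² - A_i y_i² - B_i ≤ 2 Σ_j E_ij y_i y_j
  have hrow : ∀ i, 2 * (E i i * y i ^ 2) - (∑ j ∈ univ.erase i, |E i j|) * y i ^ 2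
      - ∑ j ∈ univ.erase i, |E i j| * y j ^ 2 ≤ 2 * ∑ j, E i j * y i * y j := by
    intro i
    rw [← Finset.add_sum_erase univ (fun j => E i j * y i * y j) (Finset.mem_univ i)]
    have h1 : ∑ j ∈ univ.erase i, -(|E i j| * (y i ^ 2 + y j ^ 2))
        ≤ ∑ j ∈ univ.erase i, 2 * (E i j * y i * y j) :=
      Finset.sum_le_sum fun j _ => hterm i j
    rw [Finset.sum_neg_distrib, ← Finset.mul_sum] at h1
    have h2 : ∑ j ∈ univ.erase i, |E i j| * (y i ^ 2 + y j ^ 2)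
        = (∑ j ∈ univ.erase i, |E i j|) * y i ^ 2 + ∑ j ∈ univ.erase i, |E i j| * y j ^ 2 := by
      rw [Finset.sum_mul, ← Finset.sum_add_distrib]
      refine Finset.sum_congr rfl fun j _ => ?_
      ring
    have h3 : E i i * y i * y i = E i i * y i ^ 2 := by ring
    linarith
  have hsum := Finset.sum_le_sum fun i (_ : i ∈ (univ : Finset ι)) => hrow i
  rw [← Finset.mul_sum] at hsum
  -- swap: Σ_i Σ_{j≠i} |E_ij| y_j² = Σ_i A_i y_i²
  have hind : ∀ (g : ι → ι → ℝ) (i : ι), ∑ j ∈ univ.erase i, g i j = ∑ j, if j = i then 0 else g i j := by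
    intro g i
    rw [← Finset.add_sum_erase univ (fun j => if j = i then 0 else g i j) (Finset.mem_univ i)]
    simp only [if_true, zero_add]
    refine Finset.sum_congr rfl fun j hj => ?_
    rw [if_neg (Finset.ne_of_mem_erase hj)]
  have hswap : ∑ i, ∑ j ∈ univ.erase i, |E i j| * y j ^ 2
      = ∑ i, (∑ j ∈ univ.erase i, |E i j|) * y i ^ 2 := by
    have lhs : ∑ i, ∑ j ∈ univ.erase i, |E i j| * y j ^ 2
        = ∑ i, ∑ j, if j = i then 0 else |E i j| * y j ^ 2 :=
      Finset.sum_congr rfl fun i _ => hind (fun i j => |E i j| * y j ^ 2) i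
    have rhs : ∑ i, (∑ j ∈ univ.erase i, |E i j|) * y i ^ 2
        = ∑ i, ∑ j, if j = i then 0 else |E i j| * y i ^ 2 := by
      refine Finset.sum_congr rfl fun i _ => ?_
      rw [Finset.sum_mul]
      exact hind (fun i j => |E i j| * y i ^ 2) i
    rw [lhs, rhs, Finset.sum_comm]
    refine Finset.sum_congr rfl fun i _ => Finset.sum_congr rfl fun j _ => ?_
    by_cases h : i = j
    · subst h; simp
    · rw [if_neg h, if_neg (Ne.symm h), hs j i]
  -- named sums
  have e1 : ∑ i, (2 * (E i i * y i ^ 2) - (∑ j ∈ univ.erase i, |E i j|) * y i ^ 2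
      - ∑ j ∈ univ.erase i, |E i j| * y j ^ 2)
      = 2 * (∑ i, E i i * y i ^ 2) - (∑ i, (∑ j ∈ univ.erase i, |E i j|) * y i ^ 2)
        - ∑ i, ∑ j ∈ univ.erase i, |E i j| * y j ^ 2 := by
    rw [Finset.sum_sub_distrib, Finset.sum_sub_distrib, Finset.mul_sum]
  have hpos : 0 ≤ ∑ i, (E i i - ∑ j ∈ univ.erase i, |E i j|) * y i ^ 2 :=
    Finset.sum_nonneg fun i _ => mul_nonneg (by linarith [hA i]) (sq_nonneg _)
  have e2 : ∑ i, (E i i - ∑ j ∈ univ.erase i, |E i j|) * y i ^ 2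
      = (∑ i, E i i * y i ^ 2) - ∑ i, (∑ j ∈ univ.erase i, |E i j|) * y i ^ 2 := by
    rw [← Finset.sum_sub_distrib]
    refine Finset.sum_congr rfl fun i _ => ?_
    ring
  rw [e1, hswap] at hsum
  linarith

/-- **Split criterion.** If `Y_{ij} = Σ_c L_{ic} L_{jc} + E_{ij}` with `E` symmetric and diagonally
dominant (`Σ_j |E_{ij}| ≤ 2 E_{ii}`), then `Σ_{i,j} Y_{ij} y_i y_j ≥ 0` for every real `y`. -/
theorem quadForm_split_nonneg [DecidableEq ι] (Y E : ι → ι → ℝ) (L : ι → κ → ℝ)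
    (hY : ∀ i j, Y i j = ∑ c, L i c * L j c + E i j) (hs : ∀ i j, E i j = E j i)
    (hdd : ∀ i, ∑ j, |E i j| ≤ 2 * E i i) (y : ι → ℝ) :
    0 ≤ ∑ i, ∑ j, Y i j * y i * y j := by
  have h1 := quadForm_gram_nonneg L y
  have h2 := quadForm_diagDominant_nonneg E hs hdd y
  have : ∑ i, ∑ j, Y i j * y i * y j
      = (∑ i, ∑ j, (∑ c, L i c * L j c) * y i * y j) + ∑ i, ∑ j, E i j * y i * y j := by
    rw [← Finset.sum_add_distrib]
    refine Finset.sum_congr rfl fun i _ => ?_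
    rw [← Finset.sum_add_distrib]
    refine Finset.sum_congr rfl fun j _ => ?_
    rw [hY]; ring
  rw [this]
  exact add_nonneg h1 h2

/-- **Scaled split criterion** (integer data): if `D > 0` and `D·Y = L Lᵀ + E` entrywise with `E`
symmetric and diagonally dominant, then `Σ_{i,j} Y_{ij} y_i y_j ≥ 0`. -/
theorem quadForm_scaled_split_nonneg [DecidableEq ι] (D : ℝ) (hD : 0 < D) (Y E : ι → ι → ℝ)
    (L : ι → κ → ℝ) (hY : ∀ i j, D * Y i j = ∑ c, L i c * L j c + E i j)
    (hs : ∀ i j, E i j = E j i) (hdd : ∀ i, ∑ j, |E i j| ≤ 2 * E i i) (y : ι → ℝ) :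
    0 ≤ ∑ i, ∑ j, Y i j * y i * y j := by
  have h := quadForm_split_nonneg (fun i j => D * Y i j) E L hY hs hdd y
  have heq : ∑ i, ∑ j, (fun i j => D * Y i j) i j * y i * y j = D * ∑ i, ∑ j, Y i j * y i * y j := by
    rw [Finset.mul_sum]
    refine Finset.sum_congr rfl fun i _ => ?_
    rw [Finset.mul_sum]
    refine Finset.sum_congr rfl fun j _ => ?_
    ring
  rw [heq] at h
  exact (mul_nonneg_iff_of_pos_left hD).1 h

end Summit.Ventures.PackingBounds.Energy.GramPSD
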